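import Literature.NumberTheory.Weil1964.ArchMetaplecticBlocks
import HarnessLib

/-!
# The symplectic relations of `Sp(W)` in Folland's complex blocks: `𝒜_c⁻¹ = (P* −Qᵀ; −Q* Pᵀ)`,
# `P P* − Q Q* = 1`, `P Qᵀ = Q Pᵀ`, and `det P ≠ 0` — kernel, 0 cited facts

Topic `NumberTheory/Weil1964`; namespace `Literature.NumberTheory.Weil1964`.  Sequel to
`Literature.NumberTheory.Weil1964.ArchMetaplecticBlocks` (G3: `P(gh) = P_g P_h + Q_g Q̄_h`, `Q(gh) = P_g Q_h + Q_g P̄_h`)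
over the skeleton `Literature.NumberTheory.Weil1964.ArchMetaplecticDoubleCover` of Folland's Theorem (4.37)
(pub-hodgecm2 literature fan-out, row B07-2 (a)).  Folland §4.1 writes `𝒜 = (A B; C D) ∈ Sp(n, ℝ)` and proves
(Prop. (4.1), (4.3)) the block relations `AᵀC = CᵀA`, `BᵀD = DᵀB`, `AᵀD − CᵀB = I` together with
`𝒜⁻¹ = (Dᵀ −Bᵀ; −Cᵀ Aᵀ)`, and in complex coordinates ((4.17)–(4.18)) `𝒜_c ∈ Sp_c` iff
`P*P − QᵀQ̄ = I`, `PᵀQ̄ = Q*P`, equivalently `PP* − QQ* = I`, `PQᵀ = QPᵀ`; «in particular `P` is invertible».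
This file PROVES all of these for weil-1's `Sp(W)`, `W = ℝ^σ × ℝ^σ` with the dot pairing (the tree's
`symplecticGroup (polar (dotPairing σ))`, membership `mem_symplecticGroup`):

* §0 the defining property of `P`, `Q`: `z(g(p,q)) = P z + Q z̄` for `z = p + iq` (`phasePt_apply_eq`), and its
  converse `follandP_follandQ_unique` (how `P`, `Q` of an explicitly given element are computed);
* §1 the three left relations `AᵀD − CᵀB = 1`, `AᵀC = CᵀA`, `BᵀD = DᵀB` from `mem_symplecticGroup` evaluated on
  the pairs `((p,0),(0,q))`, `((p,0),(p',0))`, `((0,q),(0,q'))`;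
* §2 the block matrix `(A B; C D)` (`Matrix.fromBlocks`) is multiplicative (from `Sp.blockA_mul` …), hence the
  blocks of `g⁻¹` are `(Dᵀ −Bᵀ; −Cᵀ Aᵀ)` and the right relations `ADᵀ − BCᵀ = 1`, `ABᵀ = BAᵀ`, `CDᵀ = DCᵀ` hold;
* §3 complex form: `P(g⁻¹) = P(g)*` (conjugate transpose), `Q(g⁻¹) = −Q(g)ᵀ`, and — by G3 applied to
  `g g⁻¹ = 1 = g⁻¹ g` — Folland's (4.18) `P P* − Q Q* = 1`, `P Qᵀ = Q Pᵀ` and (4.17) `P* P − Qᵀ Q̄ = 1`,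
  `P* Q = Qᵀ P̄`;
* §4 `det P(g) · conj(det P(g)) = det(1 + Q Q*)`, and `det P(g) ≠ 0` (`1 + QQ*` is positive definite) — so
  Folland's normalisation `C_𝒜 = det^{-1/2} P` of the metaplectic phase is meaningful over every `g ∈ Sp(W)`;
  `det P(g⁻¹) = conj(det P(g))`.

Everything is PROVED; nothing is cited as a hypothesis, no `sorry`.

## References

* [Folland1989] G. B. Folland, *Harmonic Analysis in Phase Space*, Annals of Mathematics Studies 122, Princeton UP
  1989 (held text `book:folland1989-harmonic-analysis-phase-space`, chunk = printed page): §4.1 Prop. (4.1)–(4.3)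
  p0151, (4.11)–(4.20) p0152–p0154.
-/

set_option autoImplicit false

noncomputable section

open Complex Matrix
open scoped ComplexConjugate ComplexOrder

namespace Literature.NumberTheory.Weil1964

open Literature.Analysis.SegalBargmann Literature.RepresentationTheory.HeisenbergGroup

variable {σ : Type*} [Fintype σ] [DecidableEq σ]

namespace Sp

/-! ## 0. The defining property of `P`, `Q`: in the coordinate `z = p + iq`, `g` acts by `z ↦ P z + Q z̄` -/

/-- **`𝒜_c (z, z̄)`: `z(g(p,q)) = P(g) z + Q(g) z̄`** for `z = p + iq` (the tree's `phasePt p q`) — Folland's (4.14)–(4.16)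
read back through `𝒲`: the real-linear map `g = (A B; C D)` is `z ↦ Pz + Qz̄` with `P = ½((A+D) + i(C−B))`,
`Q = ½((A−D) + i(B+C))`. [cite: Folland1989, §4.1 (4.11)–(4.16)] -/
theorem phasePt_apply_eq (g : symplecticGroup (polar (dotPairing σ))) (p q : σ → ℝ) :
    phasePt (((g.1 : ((σ → ℝ) × (σ → ℝ)) ≃ₗ[ℝ] ((σ → ℝ) × (σ → ℝ))) (p, q)).1)
        (((g.1 : ((σ → ℝ) × (σ → ℝ)) ≃ₗ[ℝ] ((σ → ℝ) × (σ → ℝ))) (p, q)).2) =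
      follandP g *ᵥ phasePt p q + follandQ g *ᵥ star (phasePt p q) := by
  funext k
  rw [apply_eq_blocks]
  dsimp only
  rw [← LinearMap.toMatrix'_mulVec (blockA g) p, ← LinearMap.toMatrix'_mulVec (blockB g) q,
    ← LinearMap.toMatrix'_mulVec (blockC g) p, ← LinearMap.toMatrix'_mulVec (blockD g) q]
  simp only [phasePt_apply, Pi.add_apply, Matrix.mulVec, dotProduct, Pi.star_apply, follandP_apply,
    follandQ_apply, Complex.star_def, map_add, map_mul, Complex.conj_ofReal, Complex.conj_I]
  push_cast
  simp only [Finset.sum_mul, ← Finset.sum_add_distrib]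
  refine Finset.sum_congr rfl fun j _ => ?_
  have hI : I * I = -1 := Complex.I_mul_I
  linear_combination (((LinearMap.toMatrix' (blockB g) k j : ℝ) : ℂ) * (q j : ℂ)) * hI

omit [Fintype σ] in
/-- `z = p + iq` at `(e_j, 0)` is `e_j`. [folklore] -/
private theorem phasePt_single_fst'' (j : σ) : phasePt (Pi.single j (1 : ℝ)) (0 : σ → ℝ) = Pi.single j (1 : ℂ) := by
  funext k
  rw [phasePt_apply, Pi.zero_apply, Complex.ofReal_zero, zero_mul, add_zero, Pi.single_apply, Pi.single_apply]
  split_ifs <;> simp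

omit [Fintype σ] in
/-- `z = p + iq` at `(0, e_j)` is `i e_j`. [folklore] -/
private theorem phasePt_single_snd'' (j : σ) : phasePt (0 : σ → ℝ) (Pi.single j (1 : ℝ)) = Pi.single j I := by
  funext k
  rw [phasePt_apply, Pi.zero_apply, Complex.ofReal_zero, zero_add, Pi.single_apply, Pi.single_apply]
  split_ifs <;> simp

omit [Fintype σ] in
/-- `ē_j = e_j`. [folklore] -/
private theorem star_single_one (j : σ) : star (Pi.single j (1 : ℂ) : σ → ℂ) = Pi.single j (1 : ℂ) := by
  funext k
  rw [Pi.star_apply, Pi.single_apply]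
  split_ifs <;> simp

omit [Fintype σ] in
/-- `conj (i e_j) = −i e_j`. [folklore] -/
private theorem star_single_I (j : σ) : star (Pi.single j I : σ → ℂ) = Pi.single j (-I) := by
  funext k
  rw [Pi.star_apply, Pi.single_apply, Pi.single_apply]
  split_ifs <;> simp

/-- **Uniqueness of the complex blocks**: if `g` acts by `z ↦ P' z + Q' z̄` in the coordinate `z = p + iq`, then
`P' = P(g)` and `Q' = Q(g)` (test on `z = e_j` and `z = i e_j`).  This is how `P`, `Q` of an explicitly given
element of `Sp(W)` are computed. [cite: Folland1989, §4.1 (4.11)–(4.16)] -/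
theorem follandP_follandQ_unique (g : symplecticGroup (polar (dotPairing σ))) {P' Q' : Matrix σ σ ℂ}
    (h : ∀ p q : σ → ℝ,
      phasePt (((g.1 : ((σ → ℝ) × (σ → ℝ)) ≃ₗ[ℝ] ((σ → ℝ) × (σ → ℝ))) (p, q)).1)
          (((g.1 : ((σ → ℝ) × (σ → ℝ)) ≃ₗ[ℝ] ((σ → ℝ) × (σ → ℝ))) (p, q)).2) =
        P' *ᵥ phasePt p q + Q' *ᵥ star (phasePt p q)) :
    follandP g = P' ∧ follandQ g = Q' := by
  have key : ∀ i j, follandP g i j + follandQ g i j = P' i j + Q' i j ∧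
      follandP g i j * I + follandQ g i j * (-I) = P' i j * I + Q' i j * (-I) := by
    intro i j
    have h1 := congr_fun ((phasePt_apply_eq g (Pi.single j 1) 0).symm.trans (h (Pi.single j 1) 0)) i
    have h2 := congr_fun ((phasePt_apply_eq g 0 (Pi.single j 1)).symm.trans (h 0 (Pi.single j 1))) i
    rw [phasePt_single_fst'', star_single_one] at h1
    rw [phasePt_single_snd'', star_single_I] at h2
    simp only [Pi.add_apply, Matrix.mulVec_single, Matrix.col_apply, Pi.smul_apply, MulOpposite.smul_eq_mul_unop,
      MulOpposite.unop_op, mul_one] at h1 h2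
    exact ⟨h1, h2⟩
  have hI : I * I = -1 := Complex.I_mul_I
  constructor
  · ext i j
    obtain ⟨e1, e2⟩ := key i j
    linear_combination (2 : ℂ)⁻¹ * e1 + (-((2 : ℂ)⁻¹ * I)) * e2
      + ((2 : ℂ)⁻¹ * (follandP g i j - follandQ g i j - P' i j + Q' i j)) * hI
  · ext i j
    obtain ⟨e1, e2⟩ := key i j
    linear_combination (2 : ℂ)⁻¹ * e1 + ((2 : ℂ)⁻¹ * I) * e2
      + (-((2 : ℂ)⁻¹ * (follandP g i j - follandQ g i j - P' i j + Q' i j))) * hI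

/-! ## 1. The left relations `AᵀD − CᵀB = 1`, `AᵀC = CᵀA`, `BᵀD = DᵀB` -/

/-- Two real matrices with the same bilinear form `p · (X q)` are equal. [folklore] -/
private theorem eq_of_dotProduct_mulVec_eq {X Y : Matrix σ σ ℝ}
    (h : ∀ p q : σ → ℝ, p ⬝ᵥ (X *ᵥ q) = p ⬝ᵥ (Y *ᵥ q)) : X = Y := by
  ext i j
  simpa only [Matrix.mulVec_single_one, single_dotProduct, one_mul, Matrix.col_apply] using
    h (Pi.single i 1) (Pi.single j 1)

/-- `p · (Mᵀ N q) = (M_f p) · (N_h q) = f p · h q` for the matrices of two linear maps. [folklore] -/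
private theorem dotProduct_transpose_mul_mulVec (f h : (σ → ℝ) →ₗ[ℝ] (σ → ℝ)) (p q : σ → ℝ) :
    p ⬝ᵥ (((LinearMap.toMatrix' f)ᵀ * LinearMap.toMatrix' h) *ᵥ q) = f p ⬝ᵥ h q := by
  rw [← Matrix.mulVec_mulVec, Matrix.dotProduct_mulVec, Matrix.vecMul_transpose, LinearMap.toMatrix'_mulVec,
    LinearMap.toMatrix'_mulVec]

omit [DecidableEq σ] in
/-- The symplectic condition of `g ∈ Sp(W)` on a pair of vectors, in blocks-free form:
`(g w)₁ · (g w')₂ − (g w')₁ · (g w)₂ = w₁ · w'₂ − w'₁ · w₂`. [cite: Folland1989, §4.1 Prop. (4.1)] -/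
theorem symplectic_apply (g : symplecticGroup (polar (dotPairing σ))) (w w' : (σ → ℝ) × (σ → ℝ)) :
    ((g.1 : ((σ → ℝ) × (σ → ℝ)) ≃ₗ[ℝ] ((σ → ℝ) × (σ → ℝ))) w).1 ⬝ᵥ
        ((g.1 : ((σ → ℝ) × (σ → ℝ)) ≃ₗ[ℝ] ((σ → ℝ) × (σ → ℝ))) w').2 -
      ((g.1 : ((σ → ℝ) × (σ → ℝ)) ≃ₗ[ℝ] ((σ → ℝ) × (σ → ℝ))) w').1 ⬝ᵥ
        ((g.1 : ((σ → ℝ) × (σ → ℝ)) ≃ₗ[ℝ] ((σ → ℝ) × (σ → ℝ))) w).2 =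
      w.1 ⬝ᵥ w'.2 - w'.1 ⬝ᵥ w.2 := by
  have h := (mem_symplecticGroup (polar (dotPairing σ)) g.1).1 g.2 w w'
  simpa only [polar_apply, dotPairing_apply] using h

/-- **`AᵀD − CᵀB = 1`** (Folland's third relation of Prop. (4.1), from `σ(g(p,0), g(0,q)) = σ((p,0),(0,q)) = p·q`).
[cite: Folland1989, §4.1 Prop. (4.1)] -/
theorem transpose_blockA_mul_blockD_sub (g : symplecticGroup (polar (dotPairing σ))) :
    (LinearMap.toMatrix' (blockA g))ᵀ * LinearMap.toMatrix' (blockD g)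
      - (LinearMap.toMatrix' (blockC g))ᵀ * LinearMap.toMatrix' (blockB g) = 1 := by
  refine eq_of_dotProduct_mulVec_eq fun p q => ?_
  have h := symplectic_apply g (p, 0) (0, q)
  rw [apply_inl, apply_inr, zero_dotProduct, sub_zero] at h
  rw [Matrix.sub_mulVec, dotProduct_sub, dotProduct_transpose_mul_mulVec, dotProduct_transpose_mul_mulVec,
    Matrix.one_mulVec, ← h, dotProduct_comm (blockC g p)]

/-- **`AᵀC = CᵀA`** (from `σ(g(p,0), g(p',0)) = 0`). [cite: Folland1989, §4.1 Prop. (4.1)] -/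
theorem transpose_blockA_mul_blockC (g : symplecticGroup (polar (dotPairing σ))) :
    (LinearMap.toMatrix' (blockA g))ᵀ * LinearMap.toMatrix' (blockC g)
      = (LinearMap.toMatrix' (blockC g))ᵀ * LinearMap.toMatrix' (blockA g) := by
  refine eq_of_dotProduct_mulVec_eq fun p p' => ?_
  have h := symplectic_apply g (p, 0) (p', 0)
  rw [apply_inl, apply_inl, dotProduct_zero, dotProduct_zero, sub_zero, sub_eq_zero] at h
  rw [dotProduct_transpose_mul_mulVec, dotProduct_transpose_mul_mulVec, h, dotProduct_comm]

/-- **`BᵀD = DᵀB`** (from `σ(g(0,q), g(0,q')) = 0`). [cite: Folland1989, §4.1 Prop. (4.1)] -/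
theorem transpose_blockB_mul_blockD (g : symplecticGroup (polar (dotPairing σ))) :
    (LinearMap.toMatrix' (blockB g))ᵀ * LinearMap.toMatrix' (blockD g)
      = (LinearMap.toMatrix' (blockD g))ᵀ * LinearMap.toMatrix' (blockB g) := by
  refine eq_of_dotProduct_mulVec_eq fun q q' => ?_
  have h := symplectic_apply g (0, q) (0, q')
  rw [apply_inr, apply_inr, zero_dotProduct, zero_dotProduct, sub_zero, sub_eq_zero] at h
  rw [dotProduct_transpose_mul_mulVec, dotProduct_transpose_mul_mulVec, h, dotProduct_comm]

/-! ## 2. The block matrix `(A B; C D)` is multiplicative; blocks of the inverse; right relations -/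

/-- **`(A B; C D)(gh) = (A B; C D)(g) · (A B; C D)(h)`** as `2 × 2` block matrices. [cite: Folland1989, §4.1 Prop. (4.1), (4.16)] -/
theorem fromBlocks_mul (g h : symplecticGroup (polar (dotPairing σ))) :
    Matrix.fromBlocks (LinearMap.toMatrix' (blockA (g * h))) (LinearMap.toMatrix' (blockB (g * h)))
        (LinearMap.toMatrix' (blockC (g * h))) (LinearMap.toMatrix' (blockD (g * h))) =
      Matrix.fromBlocks (LinearMap.toMatrix' (blockA g)) (LinearMap.toMatrix' (blockB g))
          (LinearMap.toMatrix' (blockC g)) (LinearMap.toMatrix' (blockD g)) *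
        Matrix.fromBlocks (LinearMap.toMatrix' (blockA h)) (LinearMap.toMatrix' (blockB h))
          (LinearMap.toMatrix' (blockC h)) (LinearMap.toMatrix' (blockD h)) := by
  rw [Matrix.fromBlocks_multiply, blockA_mul, blockB_mul, blockC_mul, blockD_mul]
  simp only [map_add, LinearMap.toMatrix'_comp]

/-- `(A B; C D)(1) = 1`. [cite: Folland1989, §4.1 Prop. (4.1)] -/
theorem fromBlocks_one' :
    Matrix.fromBlocks (LinearMap.toMatrix' (blockA (1 : symplecticGroup (polar (dotPairing σ)))))
        (LinearMap.toMatrix' (blockB (1 : symplecticGroup (polar (dotPairing σ)))))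
        (LinearMap.toMatrix' (blockC (1 : symplecticGroup (polar (dotPairing σ)))))
        (LinearMap.toMatrix' (blockD (1 : symplecticGroup (polar (dotPairing σ))))) = 1 := by
  have hA : blockA (1 : symplecticGroup (polar (dotPairing σ))) = LinearMap.id := rfl
  have hD : blockD (1 : symplecticGroup (polar (dotPairing σ))) = LinearMap.id := rfl
  have hB : blockB (1 : symplecticGroup (polar (dotPairing σ))) = 0 := by
    refine LinearMap.ext fun q => ?_
    rfl
  have hC : blockC (1 : symplecticGroup (polar (dotPairing σ))) = 0 := by
    refine LinearMap.ext fun q => ?_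
    rfl
  rw [hA, hB, hC, hD, LinearMap.toMatrix'_id, map_zero, Matrix.fromBlocks_one]

/-- **`𝒜⁻¹ = (Dᵀ −Bᵀ; −Cᵀ Aᵀ)`**: the blocks of `g⁻¹` (Folland Prop. (4.3): `𝒜 ∈ Sp` iff
`𝒜⁻¹ = 𝒥𝒜ᵀ𝒥⁻¹ = (Dᵀ −Bᵀ; −Cᵀ Aᵀ)`). [cite: Folland1989, §4.1 Prop. (4.3)] -/
theorem fromBlocks_inv (g : symplecticGroup (polar (dotPairing σ))) :
    Matrix.fromBlocks (LinearMap.toMatrix' (blockA g⁻¹)) (LinearMap.toMatrix' (blockB g⁻¹))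
        (LinearMap.toMatrix' (blockC g⁻¹)) (LinearMap.toMatrix' (blockD g⁻¹)) =
      Matrix.fromBlocks (LinearMap.toMatrix' (blockD g))ᵀ (-(LinearMap.toMatrix' (blockB g))ᵀ)
        (-(LinearMap.toMatrix' (blockC g))ᵀ) (LinearMap.toMatrix' (blockA g))ᵀ := by
  -- `X(g) X(g⁻¹) = 1`
  have h1 : Matrix.fromBlocks (LinearMap.toMatrix' (blockA g)) (LinearMap.toMatrix' (blockB g))
        (LinearMap.toMatrix' (blockC g)) (LinearMap.toMatrix' (blockD g)) *
      Matrix.fromBlocks (LinearMap.toMatrix' (blockA g⁻¹)) (LinearMap.toMatrix' (blockB g⁻¹))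
        (LinearMap.toMatrix' (blockC g⁻¹)) (LinearMap.toMatrix' (blockD g⁻¹)) = 1 := by
    rw [← fromBlocks_mul, mul_inv_cancel, fromBlocks_one']
  -- `M X(g) = 1` for `M = (Dᵀ −Bᵀ; −Cᵀ Aᵀ)`, by the left relations
  have h2 : Matrix.fromBlocks (LinearMap.toMatrix' (blockD g))ᵀ (-(LinearMap.toMatrix' (blockB g))ᵀ)
        (-(LinearMap.toMatrix' (blockC g))ᵀ) (LinearMap.toMatrix' (blockA g))ᵀ *
      Matrix.fromBlocks (LinearMap.toMatrix' (blockA g)) (LinearMap.toMatrix' (blockB g))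
        (LinearMap.toMatrix' (blockC g)) (LinearMap.toMatrix' (blockD g)) = 1 := by
    have e1 : (LinearMap.toMatrix' (blockD g))ᵀ * LinearMap.toMatrix' (blockA g)
        - (LinearMap.toMatrix' (blockB g))ᵀ * LinearMap.toMatrix' (blockC g) = 1 := by
      have h := congrArg Matrix.transpose (transpose_blockA_mul_blockD_sub g)
      rwa [Matrix.transpose_sub, Matrix.transpose_mul, Matrix.transpose_mul, Matrix.transpose_transpose,
        Matrix.transpose_transpose, Matrix.transpose_one] at h
    rw [Matrix.fromBlocks_multiply, Matrix.neg_mul, Matrix.neg_mul, Matrix.neg_mul, Matrix.neg_mul,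
      ← sub_eq_add_neg, e1,
      ← sub_eq_add_neg, transpose_blockB_mul_blockD, sub_self, neg_add_eq_sub, transpose_blockA_mul_blockC,
      sub_self, neg_add_eq_sub, transpose_blockA_mul_blockD_sub, Matrix.fromBlocks_one]
  calc Matrix.fromBlocks (LinearMap.toMatrix' (blockA g⁻¹)) (LinearMap.toMatrix' (blockB g⁻¹))
        (LinearMap.toMatrix' (blockC g⁻¹)) (LinearMap.toMatrix' (blockD g⁻¹))
      = Matrix.fromBlocks (LinearMap.toMatrix' (blockD g))ᵀ (-(LinearMap.toMatrix' (blockB g))ᵀ)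
            (-(LinearMap.toMatrix' (blockC g))ᵀ) (LinearMap.toMatrix' (blockA g))ᵀ *
          (Matrix.fromBlocks (LinearMap.toMatrix' (blockA g)) (LinearMap.toMatrix' (blockB g))
              (LinearMap.toMatrix' (blockC g)) (LinearMap.toMatrix' (blockD g)) *
            Matrix.fromBlocks (LinearMap.toMatrix' (blockA g⁻¹)) (LinearMap.toMatrix' (blockB g⁻¹))
              (LinearMap.toMatrix' (blockC g⁻¹)) (LinearMap.toMatrix' (blockD g⁻¹))) := by
        rw [← Matrix.mul_assoc, h2, Matrix.one_mul]
    _ = _ := by rw [h1, Matrix.mul_one]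

/-- Block `A` of the inverse: `A(g⁻¹) = D(g)ᵀ`. [cite: Folland1989, §4.1 Prop. (4.3)] -/
theorem toMatrix'_blockA_inv (g : symplecticGroup (polar (dotPairing σ))) :
    LinearMap.toMatrix' (blockA g⁻¹) = (LinearMap.toMatrix' (blockD g))ᵀ :=
  (Matrix.fromBlocks_inj.1 (fromBlocks_inv g)).1

/-- Block `B` of the inverse: `B(g⁻¹) = −B(g)ᵀ`. [cite: Folland1989, §4.1 Prop. (4.3)] -/
theorem toMatrix'_blockB_inv (g : symplecticGroup (polar (dotPairing σ))) :
    LinearMap.toMatrix' (blockB g⁻¹) = -(LinearMap.toMatrix' (blockB g))ᵀ :=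
  (Matrix.fromBlocks_inj.1 (fromBlocks_inv g)).2.1

/-- Block `C` of the inverse: `C(g⁻¹) = −C(g)ᵀ`. [cite: Folland1989, §4.1 Prop. (4.3)] -/
theorem toMatrix'_blockC_inv (g : symplecticGroup (polar (dotPairing σ))) :
    LinearMap.toMatrix' (blockC g⁻¹) = -(LinearMap.toMatrix' (blockC g))ᵀ :=
  (Matrix.fromBlocks_inj.1 (fromBlocks_inv g)).2.2.1

/-- Block `D` of the inverse: `D(g⁻¹) = A(g)ᵀ`. [cite: Folland1989, §4.1 Prop. (4.3)] -/
theorem toMatrix'_blockD_inv (g : symplecticGroup (polar (dotPairing σ))) :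
    LinearMap.toMatrix' (blockD g⁻¹) = (LinearMap.toMatrix' (blockA g))ᵀ :=
  (Matrix.fromBlocks_inj.1 (fromBlocks_inv g)).2.2.2

/-- The right relations packaged: `(A B; C D)(g) · (Dᵀ −Bᵀ; −Cᵀ Aᵀ)(g) = 1`. [cite: Folland1989, §4.1 Prop. (4.1), (4.3)] -/
theorem fromBlocks_mul_fromBlocks_transpose (g : symplecticGroup (polar (dotPairing σ))) :
    Matrix.fromBlocks (LinearMap.toMatrix' (blockA g)) (LinearMap.toMatrix' (blockB g))
        (LinearMap.toMatrix' (blockC g)) (LinearMap.toMatrix' (blockD g)) *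
      Matrix.fromBlocks (LinearMap.toMatrix' (blockD g))ᵀ (-(LinearMap.toMatrix' (blockB g))ᵀ)
        (-(LinearMap.toMatrix' (blockC g))ᵀ) (LinearMap.toMatrix' (blockA g))ᵀ = 1 := by
  rw [← fromBlocks_inv, ← fromBlocks_mul, mul_inv_cancel, fromBlocks_one']

/-- **`ADᵀ − BCᵀ = 1`** (right relation). [cite: Folland1989, §4.1 Prop. (4.1), (4.3)] -/
theorem blockA_mul_transpose_blockD_sub (g : symplecticGroup (polar (dotPairing σ))) :
    LinearMap.toMatrix' (blockA g) * (LinearMap.toMatrix' (blockD g))ᵀ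
      - LinearMap.toMatrix' (blockB g) * (LinearMap.toMatrix' (blockC g))ᵀ = 1 := by
  have h := fromBlocks_mul_fromBlocks_transpose g
  rw [Matrix.fromBlocks_multiply, ← Matrix.fromBlocks_one, Matrix.fromBlocks_inj] at h
  rw [sub_eq_add_neg, ← Matrix.mul_neg]
  exact h.1

/-- **`ABᵀ = BAᵀ`** (right relation). [cite: Folland1989, §4.1 Prop. (4.1), (4.3)] -/
theorem blockA_mul_transpose_blockB (g : symplecticGroup (polar (dotPairing σ))) :
    LinearMap.toMatrix' (blockA g) * (LinearMap.toMatrix' (blockB g))ᵀ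
      = LinearMap.toMatrix' (blockB g) * (LinearMap.toMatrix' (blockA g))ᵀ := by
  have h := fromBlocks_mul_fromBlocks_transpose g
  rw [Matrix.fromBlocks_multiply, ← Matrix.fromBlocks_one, Matrix.fromBlocks_inj] at h
  have h2 := h.2.1
  rw [Matrix.mul_neg, neg_add_eq_sub, sub_eq_zero] at h2
  exact h2.symm

/-- **`CDᵀ = DCᵀ`** (right relation). [cite: Folland1989, §4.1 Prop. (4.1), (4.3)] -/
theorem blockC_mul_transpose_blockD (g : symplecticGroup (polar (dotPairing σ))) :
    LinearMap.toMatrix' (blockC g) * (LinearMap.toMatrix' (blockD g))ᵀ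
      = LinearMap.toMatrix' (blockD g) * (LinearMap.toMatrix' (blockC g))ᵀ := by
  have h := fromBlocks_mul_fromBlocks_transpose g
  rw [Matrix.fromBlocks_multiply, ← Matrix.fromBlocks_one, Matrix.fromBlocks_inj] at h
  have h3 := h.2.2.1
  rw [Matrix.mul_neg, ← sub_eq_add_neg, sub_eq_zero] at h3
  exact h3

/-! ## 3. Complex form: `P(g⁻¹) = P*`, `Q(g⁻¹) = −Qᵀ`, Folland (4.17)–(4.18) -/

/-- **`P(g⁻¹) = P(g)*`** (conjugate transpose): `(𝒜⁻¹)_c = (𝒜_c)⁻¹ = (P* −Qᵀ; −Q* Pᵀ)`.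
[cite: Folland1989, §4.1 Prop. (4.3), (4.17)] -/
theorem follandP_inv (g : symplecticGroup (polar (dotPairing σ))) : follandP g⁻¹ = (follandP g)ᴴ := by
  ext i j
  rw [Matrix.conjTranspose_apply, follandP_apply, follandP_apply, toMatrix'_blockA_inv, toMatrix'_blockB_inv,
    toMatrix'_blockC_inv, toMatrix'_blockD_inv, Matrix.neg_apply, Matrix.neg_apply, Matrix.transpose_apply,
    Matrix.transpose_apply, Matrix.transpose_apply, Matrix.transpose_apply, Complex.star_def, map_mul, map_add,
    map_add, map_mul, map_sub, map_inv₀, map_ofNat, Complex.conj_ofReal, Complex.conj_ofReal, Complex.conj_ofReal,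
    Complex.conj_ofReal, Complex.conj_I]
  push_cast
  ring

/-- **`Q(g⁻¹) = −Q(g)ᵀ`**. [cite: Folland1989, §4.1 Prop. (4.3), (4.17)] -/
theorem follandQ_inv (g : symplecticGroup (polar (dotPairing σ))) : follandQ g⁻¹ = -(follandQ g)ᵀ := by
  ext i j
  rw [Matrix.neg_apply, Matrix.transpose_apply, follandQ_apply, follandQ_apply, toMatrix'_blockA_inv,
    toMatrix'_blockB_inv, toMatrix'_blockC_inv, toMatrix'_blockD_inv, Matrix.neg_apply, Matrix.neg_apply,
    Matrix.transpose_apply, Matrix.transpose_apply, Matrix.transpose_apply, Matrix.transpose_apply]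
  push_cast
  ring

omit [Fintype σ] [DecidableEq σ] in
/-- Entrywise conjugate of a conjugate transpose is the transpose. [folklore] -/
private theorem map_conj_conjTranspose (M : Matrix σ σ ℂ) : Mᴴ.map conj = Mᵀ := by
  ext i j
  rw [Matrix.map_apply, Matrix.conjTranspose_apply, Matrix.transpose_apply, Complex.star_def, Complex.conj_conj]

omit [Fintype σ] [DecidableEq σ] in
/-- Entrywise conjugate of (minus) a transpose is (minus) the conjugate transpose. [folklore] -/
private theorem map_conj_neg_transpose (M : Matrix σ σ ℂ) : (-Mᵀ).map conj = -Mᴴ := by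
  ext i j
  rw [Matrix.map_apply, Matrix.neg_apply, Matrix.neg_apply, Matrix.transpose_apply, Matrix.conjTranspose_apply,
    map_neg, Complex.star_def]

/-- **Folland (4.18), first relation: `P P* − Q Q* = 1`** (G3 on `g g⁻¹ = 1`). In particular `P P* = 1 + Q Q* ≥ 1`.
[cite: Folland1989, §4.1 (4.17)–(4.18)] -/
theorem follandP_mul_conjTranspose_sub (g : symplecticGroup (polar (dotPairing σ))) :
    follandP g * (follandP g)ᴴ - follandQ g * (follandQ g)ᴴ = 1 := by
  have h := follandP_mul g g⁻¹
  rw [mul_inv_cancel, follandP_one, follandP_inv, follandQ_inv, map_conj_neg_transpose, Matrix.mul_neg,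
    ← sub_eq_add_neg] at h
  exact h.symm

/-- **Folland (4.18), second relation: `P Qᵀ = Q Pᵀ`** (G3 on `g g⁻¹ = 1`, `Q`-block).
[cite: Folland1989, §4.1 (4.17)–(4.18)] -/
theorem follandP_mul_transpose_follandQ (g : symplecticGroup (polar (dotPairing σ))) :
    follandP g * (follandQ g)ᵀ = follandQ g * (follandP g)ᵀ := by
  have h := follandQ_mul g g⁻¹
  rw [mul_inv_cancel, follandQ_one, follandP_inv, follandQ_inv, map_conj_conjTranspose, Matrix.mul_neg,
    neg_add_eq_sub, eq_comm, sub_eq_zero] at h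
  exact h.symm

/-- **Folland (4.17), first relation: `P* P − Qᵀ Q̄ = 1`** (G3 on `g⁻¹ g = 1`; `Q̄` the entrywise conjugate).
[cite: Folland1989, §4.1 (4.17)] -/
theorem conjTranspose_follandP_mul_sub (g : symplecticGroup (polar (dotPairing σ))) :
    (follandP g)ᴴ * follandP g - (follandQ g)ᵀ * (follandQ g).map conj = 1 := by
  have h := follandP_mul g⁻¹ g
  rw [inv_mul_cancel, follandP_one, follandP_inv, follandQ_inv, Matrix.neg_mul, ← sub_eq_add_neg] at h
  exact h.symm

/-- **Folland (4.17), second relation: `P* Q = Qᵀ P̄`** (G3 on `g⁻¹ g = 1`, `Q`-block).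
[cite: Folland1989, §4.1 (4.17)] -/
theorem conjTranspose_follandP_mul_follandQ (g : symplecticGroup (polar (dotPairing σ))) :
    (follandP g)ᴴ * follandQ g = (follandQ g)ᵀ * (follandP g).map conj := by
  have h := follandQ_mul g⁻¹ g
  rw [inv_mul_cancel, follandQ_one, follandP_inv, follandQ_inv, Matrix.neg_mul, ← sub_eq_add_neg, eq_comm,
    sub_eq_zero] at h
  exact h

/-! ## 4. `det P ≠ 0` -/

/-- `P P* = 1 + Q Q*`. [cite: Folland1989, §4.1 (4.18)–(4.20)] -/
theorem follandP_mul_conjTranspose (g : symplecticGroup (polar (dotPairing σ))) :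
    follandP g * (follandP g)ᴴ = 1 + follandQ g * (follandQ g)ᴴ := by
  rw [← follandP_mul_conjTranspose_sub g, sub_add_cancel]

/-- `1 + Q Q*` is positive definite. [cite: Folland1989, §4.1 (4.18)–(4.20)] -/
theorem posDef_one_add_follandQ_mul_conjTranspose (g : symplecticGroup (polar (dotPairing σ))) :
    (1 + follandQ g * (follandQ g)ᴴ).PosDef :=
  Matrix.PosDef.one.add_posSemidef (Matrix.posSemidef_self_mul_conjTranspose _)

/-- **`det P · conj(det P) = det(1 + Q Q*)`**, i.e. `|det P|² = det(1 + QQ*)`. [cite: Folland1989, §4.1 (4.18)–(4.20)] -/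
theorem det_follandP_mul_conj (g : symplecticGroup (polar (dotPairing σ))) :
    (follandP g).det * conj (follandP g).det = (1 + follandQ g * (follandQ g)ᴴ).det := by
  rw [← follandP_mul_conjTranspose, Matrix.det_mul, Matrix.det_conjTranspose, Complex.star_def]

/-- **`det P(g) ≠ 0` for every `g ∈ Sp(W)`** («in particular, `P` is invertible», after (4.18)): so the
normalisation `C_𝒜 = det^{-1/2} P` of the metaplectic phase makes sense over all of `Sp(W)`.
[cite: Folland1989, §4.1 (4.18)–(4.20)] -/
theorem det_follandP_ne_zero (g : symplecticGroup (polar (dotPairing σ))) : (follandP g).det ≠ 0 := by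
  intro h
  have hu : IsUnit (1 + follandQ g * (follandQ g)ᴴ).det :=
    (Matrix.isUnit_iff_isUnit_det _).1 (posDef_one_add_follandQ_mul_conjTranspose g).isUnit
  rw [← det_follandP_mul_conj, h, zero_mul] at hu
  exact not_isUnit_zero hu

/-- `P(g)` is invertible. [cite: Folland1989, §4.1 (4.18)–(4.20)] -/
theorem isUnit_follandP (g : symplecticGroup (polar (dotPairing σ))) : IsUnit (follandP g) :=
  (Matrix.isUnit_iff_isUnit_det _).2 (isUnit_iff_ne_zero.2 (det_follandP_ne_zero g))

/-- `det P(g⁻¹) = conj(det P(g))`. [cite: Folland1989, §4.1 Prop. (4.3), (4.17)] -/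
theorem det_follandP_inv (g : symplecticGroup (polar (dotPairing σ))) :
    (follandP g⁻¹).det = conj (follandP g).det := by
  rw [follandP_inv, Matrix.det_conjTranspose, Complex.star_def]

end Sp

end Literature.NumberTheory.Weil1964
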